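import Summits.NavierStokesRegularity.NavierStokesRegularity.Theorems.SqueezeCycleExtremalBiaxialitySubcriticalOfLiouville
import Summits.NavierStokesRegularity.NavierStokesRegularity.Theorems.SqueezeCycleExtremalBiaxialitySubcriticalSmallConstant
import Summits.NavierStokesRegularity.NavierStokesRegularity.Theorems.SqueezeCycleExtremalElementExistsRescale
import HarnessLib

/-!
# Route `SqueezeCycle`, crux `ExtremalBiaxialitySubcritical` — structure of an extremal configuration

Helper file for item `stmt-NavierStokesRegularity-11609`
(`Summit.NavierStokesRegularity.NavierStokesRegularity.Theses.SqueezeCycle.ExtremalBiaxialitySubcritical`).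
An *extremal configuration* is the hypothesis package of the crux: `u ∈ 𝒦_C`, `t₀ < 0`, `x₀`,
`m`, the attainment clause (Courant–Fischer lower two-frame form of "`Λ_u(t₀,x₀) ≥ m`") and the
maximality clause ("`Λ_v ≤ m` on all of `𝒦_C × (−∞,0) × ℝ³`", upper two-frame form). In the
tree's vocabulary `Λ = Literature.Analysis.FluidPDE.lerayMiddleStrain` and the two-frame forms are
`le_lerayMiddleStrain_iff` / `lerayMiddleStrain_le_iff`. This file records what such a
configuration looks like before any mechanism is applied:

* `extremal_lerayMiddleStrain_eq` — the two clauses pin the number: `Λ_u(t₀, x₀) = m`, and `m`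
  is the maximum of `Λ` over the class;
* `extremal_pos_imp_large_constant` — if `m > 0` the Type-I constant exceeds the universal
  smallness threshold `ε` of `squeezeClass_eq_zero_of_small` (below it the class is `{0}`);
* `extremal_not_future_shift_mem` — **record holders are rooted at `t = 0`**: if `m > 0`, no
  future time-shift `t ↦ u(t + δ)`, `δ > 0`, of the extremal element belongs to `𝒦_C` (it would
  carry the value `(1 + δ/(−t₀)) m > m` of `Λ` at `(t₀ − δ, x₀)`, against maximality) — the
  only symmetry of the problem that raises `Λ` is inadmissible exactly at an extremal element, so
  class-maximality is silent on symmetry orbits (all admissible ones — scaling, translation, past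
  shifts — preserve or lower `Λ`);
* `extremal_normalise` — **WLOG `(t₀, x₀) = (−1, 0)`**: the Navier–Stokes zoom with factor
  `c = √(−t₀)` about `x₀` (`SqueezeCycleExtremalElementExistsRescale`: the class and `Λ` are zoom
  invariant) carries an extremal configuration to one attained at `(−1, 0)` with the same `C`, `m`.
-/

noncomputable section

open MeasureTheory Set Function Filter Metric
open scoped RealInnerProductSpace

namespace Summit.NavierStokesRegularity.NavierStokesRegularity.Theorems

open Literature.Analysis Literature.Analysis.FluidPDE
open Summit.NavierStokesRegularity.NavierStokesRegularity.Theses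

/-! ### The two clauses pin `Λ_u(t₀,x₀) = m = max Λ` -/

/-- **An extremal configuration attains exactly `m`**: the attainment clause is `m ≤ Λ_u(t₀,x₀)`
(`le_lerayMiddleStrain_iff`) and maximality tested on `u` itself is `Λ_u(t₀,x₀) ≤ m`
(`lerayMiddleStrain_le_iff`). [folklore] -/
theorem extremal_lerayMiddleStrain_eq {C m t₀ : ℝ}
    {u : ℝ → EuclideanSpace ℝ (Fin 3) → EuclideanSpace ℝ (Fin 3)} {x₀ : EuclideanSpace ℝ (Fin 3)}
    (ht₀ : t₀ < 0)
    (hu : ContDiffOn ℝ (⊤ : ℕ∞) (Function.uncurry u) (Set.Iio 0 ×ˢ Set.univ) ∧ (∀ t < 0, Literature.Analysis.FluidPDE.VectorCalculus.IsDivFree (u t)) ∧ (∀ s t : ℝ, s < t → t < 0 → ∀ x, u t x = Literature.Analysis.FluidPDE.heatFlow (u s) (t-s) x - ∫ τ in Set.Ioo s t, ∫ y, ((-(inner ℝ (x-y) (u τ y) / (2*(t-τ)) * Literature.Analysis.UnboundedOperators.heatKernel (t-τ) (x-y))) • u τ y + (∫ σ in Set.Ioi (t-τ), Literature.Analysis.UnboundedOperators.heatKernel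 σ (x-y) / (4*σ^2)) • (inner ℝ (x-y) (u τ y) • u τ y + inner ℝ (u τ y) (u τ y) • (x-y) + inner ℝ (x-y) (u τ y) • u τ y) - ((∫ σ in Set.Ioi (t-τ), Literature.Analysis.UnboundedOperators.heatKernel σ (x-y) / (8*σ^3)) * (inner ℝ (x-y) (u τ y) * inner ℝ (x-y) (u τ y))) • (x-y))) ∧ Literature.Analysis.FluidPDE.HasTypeITimeDecay C u ∧ (∀ (x₀ : EuclideanSpace ℝ (Fin 3)) (t₀ r : ℝ), t₀ ≤ 0 → 0 < r → (∀ t, t₀ - r^2 < t → t < t₀ → r⁻¹ * ∫ x in Metric.ball x₀ r, ‖u t x‖^2 ≤ C) ∧ r⁻¹ * ∫ t in Set.Ioo (t₀ - r^2) t₀, ∫ x in Metric.ball x₀ r, ‖fderiv ℝ (u t) x‖^2 ≤ C))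
    (hGE : ∃ v w : EuclideanSpace ℝ (Fin 3), ‖v‖ = 1 ∧ ‖w‖ = 1 ∧ inner ℝ v w = 0 ∧ ∀ α β : ℝ, m * (α^2 + β^2) ≤ (-t₀) * inner ℝ (fderiv ℝ (u t₀) x₀ (α • v + β • w)) (α • v + β • w))
    (hmax : ∀ v' : ℝ → EuclideanSpace ℝ (Fin 3) → EuclideanSpace ℝ (Fin 3), ContDiffOn ℝ (⊤ : ℕ∞) (Function.uncurry v') (Set.Iio 0 ×ˢ Set.univ) ∧ (∀ t < 0, Literature.Analysis.FluidPDE.VectorCalculus.IsDivFree (v' t)) ∧ (∀ s t : ℝ, s < t → t < 0 → ∀ x, v' t x = Literature.Analysis.FluidPDE.heatFlow (v' s) (t-s) x - ∫ τ in Set.Ioo s t, ∫ y, ((-(inner ℝ (x-y) (v' τ y) / (2*(t-τ)) * Literature.Analysis.UnboundedOperators.heatKernel (t-τ) (x-y))) • v' τ y + (∫ σ in Set.Ioi (t-τ), Literature.Analysis.UnboundedOperators.heatKernel σ (x-y) / (4*σ^2)) • (inner ℝ (x-y) (v' τ y) • v' τ y + inner ℝ (v' τ y) (v' τ y) • (x-y)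 + inner ℝ (x-y) (v' τ y) • v' τ y) - ((∫ σ in Set.Ioi (t-τ), Literature.Analysis.UnboundedOperators.heatKernel σ (x-y) / (8*σ^3)) * (inner ℝ (x-y) (v' τ y) * inner ℝ (x-y) (v' τ y))) • (x-y))) ∧ Literature.Analysis.FluidPDE.HasTypeITimeDecay C v' ∧ (∀ (x₀ : EuclideanSpace ℝ (Fin 3)) (t₀ r : ℝ), t₀ ≤ 0 → 0 < r → (∀ t, t₀ - r^2 < t → t < t₀ → r⁻¹ * ∫ x in Metric.ball x₀ r, ‖v' t x‖^2 ≤ C) ∧ r⁻¹ * ∫ t in Set.Ioo (t₀ - r^2) t₀, ∫ x in Metric.ball x₀ r, ‖fderiv ℝ (v' t) x‖^2 ≤ C) → ∀ t < 0, ∀ x, (∃ v w : EuclideanSpace ℝ (Fin 3), ‖v‖ = 1 ∧ ‖w‖ = 1 ∧ inner ℝ v w = 0 ∧ ∀ α β : ℝ, (-t) * inner ℝ (fderiv ℝ (v' t) x (α • v + β • w)) (α • v + β • w) ≤ m * (α^2 + β^2))) :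
    lerayMiddleStrain u t₀ x₀ = m ∧
      ∀ v' : ℝ → EuclideanSpace ℝ (Fin 3) → EuclideanSpace ℝ (Fin 3), (ContDiffOn ℝ (⊤ : ℕ∞) (Function.uncurry v') (Set.Iio 0 ×ˢ Set.univ) ∧ (∀ t < 0, Literature.Analysis.FluidPDE.VectorCalculus.IsDivFree (v' t)) ∧ (∀ s t : ℝ, s < t → t < 0 → ∀ x, v' t x = Literature.Analysis.FluidPDE.heatFlow (v' s) (t-s) x - ∫ τ in Set.Ioo s t, ∫ y, ((-(inner ℝ (x-y) (v' τ y) / (2*(t-τ)) * Literature.Analysis.UnboundedOperators.heatKernel (t-τ) (x-y))) • v' τ y + (∫ σ in Set.Ioi (t-τ), Literature.Analysis.UnboundedOperators.heatKernel σ (x-y) / (4*σ^2)) • (inner ℝ (x-y) (v' τ y) • v' τ y + inner ℝ (v' τ y) (v' τ y) • (x-y) + inner ℝ (x-y) (v' τ y) • v' τ y) - ((∫ σ in Set.Ioi (t-τ), Literature.Analysis.UnboundedOperators.heatKernel σ (x-y) / (8*σ^3)) * (inner ℝ (x-y) (v' τ y) * inner ℝ (x-y) (v' τ y))) • (x-y)))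 ∧ Literature.Analysis.FluidPDE.HasTypeITimeDecay C v' ∧ (∀ (x₀ : EuclideanSpace ℝ (Fin 3)) (t₀ r : ℝ), t₀ ≤ 0 → 0 < r → (∀ t, t₀ - r^2 < t → t < t₀ → r⁻¹ * ∫ x in Metric.ball x₀ r, ‖v' t x‖^2 ≤ C) ∧ r⁻¹ * ∫ t in Set.Ioo (t₀ - r^2) t₀, ∫ x in Metric.ball x₀ r, ‖fderiv ℝ (v' t) x‖^2 ≤ C)) → ∀ t < 0, ∀ x, lerayMiddleStrain v' t x ≤ m := by
  have hge : m ≤ lerayMiddleStrain u t₀ x₀ := (le_lerayMiddleStrain_iff ht₀ m).2 hGE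
  have hle : ∀ v', _ → ∀ t < 0, ∀ x, lerayMiddleStrain v' t x ≤ m := fun v' hv' t ht x =>
    (lerayMiddleStrain_le_iff ht m).2 (hmax v' hv' t ht x)
  exact ⟨le_antisymm (hle u hu t₀ ht₀ x₀) hge, hle⟩

/-! ### A positive record forces a large Type-I constant -/

/-- **Positive squeeze needs a large Type-I constant**: with the universal `ε > 0` of
`squeezeClass_eq_zero_of_small` (for `C ≤ ε` the class `𝒦_C` is `{0}`), an element of `𝒦_C`
attaining a Leray-gauge middle strain eigenvalue `≥ m > 0` at some `(t₀, x₀)`, `t₀ < 0`, has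
`C > ε` (otherwise `u ≡ 0`, its gradient vanishes and `m ≤ 0`). [folklore] -/
theorem extremal_pos_imp_large_constant :
    ∃ ε : ℝ, 0 < ε ∧ ∀ (C m : ℝ) (u : ℝ → EuclideanSpace ℝ (Fin 3) → EuclideanSpace ℝ (Fin 3)) (t₀ : ℝ) (x₀ : EuclideanSpace ℝ (Fin 3)),
      0 < m → t₀ < 0 → (ContDiffOn ℝ (⊤ : ℕ∞) (Function.uncurry u) (Set.Iio 0 ×ˢ Set.univ) ∧ (∀ t < 0, Literature.Analysis.FluidPDE.VectorCalculus.IsDivFree (u t)) ∧ (∀ s t : ℝ, s < t → t < 0 → ∀ x, u t x = Literature.Analysis.FluidPDE.heatFlow (u s) (t-s) x - ∫ τ in Set.Ioo s t, ∫ y, ((-(inner ℝ (x-y) (u τ y) / (2*(t-τ)) * Literature.Analysis.UnboundedOperators.heatKernel (t-τ) (x-y))) • u τ y + (∫ σ in Set.Ioi (t-τ), Literature.Analysis.UnboundedOperators.heatKernel σ (x-y) / (4*σ^2)) • (inner ℝ (x-y) (u τ y) • u τ y + inner ℝ (u τ y) (u τ y) • (x-y) + inner ℝ (x-y) (u τ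 y) • u τ y) - ((∫ σ in Set.Ioi (t-τ), Literature.Analysis.UnboundedOperators.heatKernel σ (x-y) / (8*σ^3)) * (inner ℝ (x-y) (u τ y) * inner ℝ (x-y) (u τ y))) • (x-y))) ∧ Literature.Analysis.FluidPDE.HasTypeITimeDecay C u ∧ (∀ (x₀ : EuclideanSpace ℝ (Fin 3)) (t₀ r : ℝ), t₀ ≤ 0 → 0 < r → (∀ t, t₀ - r^2 < t → t < t₀ → r⁻¹ * ∫ x in Metric.ball x₀ r, ‖u t x‖^2 ≤ C) ∧ r⁻¹ * ∫ t in Set.Ioo (t₀ - r^2) t₀, ∫ x in Metric.ball x₀ r, ‖fderiv ℝ (u t) x‖^2 ≤ C)) → (∃ v w : EuclideanSpace ℝ (Fin 3), ‖v‖ = 1 ∧ ‖w‖ = 1 ∧ inner ℝ v w = 0 ∧ ∀ α β : ℝ, m * (α^2 + β^2) ≤ (-t₀) * inner ℝ (fderiv ℝ (u t₀) x₀ (α • v + β • w)) (α • v + β • w)) → ε < C := by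
  obtain ⟨ε, hε, hzero⟩ := squeezeClass_eq_zero_of_small
  refine ⟨ε, hε, fun C m u t₀ x₀ hm ht₀ hu hGE => ?_⟩
  by_contra hC
  rw [not_lt] at hC
  have hz : ∀ x, u t₀ x = 0 := fun x => hzero C u hC hu t₀ ht₀ x
  have h0 : m ≤ 0 := nonpos_of_twoFrame_lower_of_slice_zero hz hGE
  linarith

/-! ### Record holders are rooted at `t = 0` -/

/-- **The Leray-gauge observable of a future time-shift**: for `v(t) = u(t + δ)`,
`Λ_v(t₀ − δ, x₀) = ((−t₀ + δ)/(−t₀)) · Λ_u(t₀, x₀)` (same gradient `∇u(t₀, x₀)`, gauge factor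
`−(t₀ − δ)` instead of `−t₀`). [folklore] -/
theorem lerayMiddleStrain_future_shift (u : ℝ → EuclideanSpace ℝ (Fin 3) → EuclideanSpace ℝ (Fin 3))
    {t₀ : ℝ} (ht₀ : t₀ < 0) (δ : ℝ) (x₀ : EuclideanSpace ℝ (Fin 3)) :
    lerayMiddleStrain (fun t => u (t + δ)) (t₀ - δ) x₀ =
      (-(t₀ - δ)) / (-t₀) * lerayMiddleStrain u t₀ x₀ := by
  rw [lerayMiddleStrain_def, lerayMiddleStrain_def]
  simp only [sub_add_cancel]
  have ht : t₀ ≠ 0 := by linarith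
  field_simp

/-- **Record holders are rooted: no future time-shift of an extremal element stays in the class.**
If `u` attains a Leray-gauge middle strain eigenvalue `≥ m > 0` at `(t₀, x₀)`, `t₀ < 0`, and `m`
bounds `Λ` on all of `𝒦_C` (the crux's maximality clause), then for every `δ > 0` the future
shift `t ↦ u(t + δ)` is NOT an element of `𝒦_C`: it would carry the value
`(1 + δ/(−t₀)) · Λ_u(t₀, x₀) > m` at `(t₀ − δ, x₀)` (`lerayMiddleStrain_future_shift`). So the one
symmetry of Navier–Stokes that raises `Λ` (re-anchoring the blow-up time into the future) is
inadmissible exactly at an extremal element — equivalently, an extremal element admits no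
extension within `𝒦_C` beyond `t = 0`; the admissible symmetries (scaling, translations, past
shifts) preserve or lower `Λ`, so class-maximality is silent on symmetry orbits. [folklore] -/
theorem extremal_not_future_shift_mem {C m t₀ : ℝ}
    {u : ℝ → EuclideanSpace ℝ (Fin 3) → EuclideanSpace ℝ (Fin 3)} {x₀ : EuclideanSpace ℝ (Fin 3)}
    (ht₀ : t₀ < 0) (hm : 0 < m)
    (hGE : ∃ v w : EuclideanSpace ℝ (Fin 3), ‖v‖ = 1 ∧ ‖w‖ = 1 ∧ inner ℝ v w = 0 ∧ ∀ α β : ℝ, m * (α^2 + β^2) ≤ (-t₀) * inner ℝ (fderiv ℝ (u t₀) x₀ (α • v + β • w)) (α • v + β • w))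
    (hmax : ∀ v' : ℝ → EuclideanSpace ℝ (Fin 3) → EuclideanSpace ℝ (Fin 3), ContDiffOn ℝ (⊤ : ℕ∞) (Function.uncurry v') (Set.Iio 0 ×ˢ Set.univ) ∧ (∀ t < 0, Literature.Analysis.FluidPDE.VectorCalculus.IsDivFree (v' t)) ∧ (∀ s t : ℝ, s < t → t < 0 → ∀ x, v' t x = Literature.Analysis.FluidPDE.heatFlow (v' s) (t-s) x - ∫ τ in Set.Ioo s t, ∫ y, ((-(inner ℝ (x-y) (v' τ y) / (2*(t-τ)) * Literature.Analysis.UnboundedOperators.heatKernel (t-τ) (x-y))) • v' τ y + (∫ σ in Set.Ioi (t-τ), Literature.Analysis.UnboundedOperators.heatKernel σ (x-y) / (4*σ^2)) • (inner ℝ (x-y) (v' τ y) • v' τ y + inner ℝ (v' τ y) (v' τ y) • (x-y) + inner ℝ (x-y) (v' τ y) • v' τ y) - ((∫ σ in Set.Ioi (t-τ), Literature.Analysis.UnboundedOperators.heatKernel σ (x-y) / (8*σ^3)) * (inner ℝ (x-y) (v' τ y) * inner ℝ (x-y) (v' τ y))) • (x-y))) ∧ Literature.Analysis.FluidPDE.HasTypeITimeDecay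 C v' ∧ (∀ (x₀ : EuclideanSpace ℝ (Fin 3)) (t₀ r : ℝ), t₀ ≤ 0 → 0 < r → (∀ t, t₀ - r^2 < t → t < t₀ → r⁻¹ * ∫ x in Metric.ball x₀ r, ‖v' t x‖^2 ≤ C) ∧ r⁻¹ * ∫ t in Set.Ioo (t₀ - r^2) t₀, ∫ x in Metric.ball x₀ r, ‖fderiv ℝ (v' t) x‖^2 ≤ C) → ∀ t < 0, ∀ x, (∃ v w : EuclideanSpace ℝ (Fin 3), ‖v‖ = 1 ∧ ‖w‖ = 1 ∧ inner ℝ v w = 0 ∧ ∀ α β : ℝ, (-t) * inner ℝ (fderiv ℝ (v' t) x (α • v + β • w)) (α • v + β • w) ≤ m * (α^2 + β^2)))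
    {δ : ℝ} (hδ : 0 < δ) :
    ¬ (ContDiffOn ℝ (⊤ : ℕ∞) (Function.uncurry (fun t => u (t + δ))) (Set.Iio 0 ×ˢ Set.univ) ∧ (∀ t < 0, Literature.Analysis.FluidPDE.VectorCalculus.IsDivFree ((fun t => u (t + δ)) t)) ∧ (∀ s t : ℝ, s < t → t < 0 → ∀ x, (fun t => u (t + δ)) t x = Literature.Analysis.FluidPDE.heatFlow ((fun t => u (t + δ)) s) (t-s) x - ∫ τ in Set.Ioo s t, ∫ y, ((-(inner ℝ (x-y) ((fun t => u (t + δ)) τ y) / (2*(t-τ)) * Literature.Analysis.UnboundedOperators.heatKernel (t-τ) (x-y))) • (fun t => u (t + δ)) τ y + (∫ σ in Set.Ioi (t-τ), Literature.Analysis.UnboundedOperators.heatKernel σ (x-y) / (4*σ^2)) • (inner ℝ (x-y) ((fun t => u (t + δ)) τ y) • (fun t => u (t + δ)) τ y + inner ℝ ((fun t => u (t + δ)) τ y) ((fun t => u (t + δ)) τ y) • (x-y) + inner ℝ (x-y) ((fun t => u (t + δ)) τ y) • (fun t => u (t + δ)) τ y) - ((∫ σ in Set.Ioi (t-τ), Literature.Analysis.UnboundedOperators.heatKernel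 σ (x-y) / (8*σ^3)) * (inner ℝ (x-y) ((fun t => u (t + δ)) τ y) * inner ℝ (x-y) ((fun t => u (t + δ)) τ y))) • (x-y))) ∧ Literature.Analysis.FluidPDE.HasTypeITimeDecay C (fun t => u (t + δ)) ∧ (∀ (x₀ : EuclideanSpace ℝ (Fin 3)) (t₀ r : ℝ), t₀ ≤ 0 → 0 < r → (∀ t, t₀ - r^2 < t → t < t₀ → r⁻¹ * ∫ x in Metric.ball x₀ r, ‖(fun t => u (t + δ)) t x‖^2 ≤ C) ∧ r⁻¹ * ∫ t in Set.Ioo (t₀ - r^2) t₀, ∫ x in Metric.ball x₀ r, ‖fderiv ℝ ((fun t => u (t + δ)) t) x‖^2 ≤ C)) := by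
  intro hmem
  have ht' : t₀ - δ < 0 := by linarith
  have h1 : m ≤ lerayMiddleStrain u t₀ x₀ := (le_lerayMiddleStrain_iff ht₀ m).2 hGE
  have h2 : lerayMiddleStrain (fun t => u (t + δ)) (t₀ - δ) x₀ ≤ m :=
    (lerayMiddleStrain_le_iff ht' m).2 (hmax _ hmem (t₀ - δ) ht' x₀)
  rw [lerayMiddleStrain_future_shift u ht₀ δ x₀] at h2
  have hpos : 0 < lerayMiddleStrain u t₀ x₀ := hm.trans_le h1
  have hfac : 1 < (-(t₀ - δ)) / (-t₀) := by
    rw [one_lt_div (by linarith)]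
    linarith
  have hlt : lerayMiddleStrain u t₀ x₀ < (-(t₀ - δ)) / (-t₀) * lerayMiddleStrain u t₀ x₀ :=
    lt_mul_left hpos hfac
  linarith

/-! ### Normalisation of the extremal point -/

/-- **WLOG the squeeze is attained at `(t₀, x₀) = (−1, 0)`.** If `u ∈ 𝒦_C` attains a
Leray-gauge middle strain eigenvalue `≥ m` at `(t₀, x₀)`, `t₀ < 0`, then the Navier–Stokes zoom
`u'(s, y) = c · u(c²s, x₀ + cy)` with `c = √(−t₀)` is an element of `𝒦_C` (same constant:
`isTypeIAncientMild_zoom`, `scaledEnergy_zoom`, `scaledGradEnergy_zoom` of the sibling file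
`SqueezeCycleExtremalElementExistsRescale`) attaining `≥ m` at `(−1, 0)`
(`lerayMiddleStrain_zoom`: `Λ_{u'}(−1, 0) = Λ_u(t₀, x₀)`). The crux's maximality clause is
class-wide and is therefore unchanged. [cite: KochNadirashviliSereginSverak2009, §1 (1.2) (arXiv:0709.3599 p. 2)] -/
theorem extremal_normalise {C m t₀ : ℝ}
    {u : ℝ → EuclideanSpace ℝ (Fin 3) → EuclideanSpace ℝ (Fin 3)} {x₀ : EuclideanSpace ℝ (Fin 3)}
    (ht₀ : t₀ < 0) (hu : ContDiffOn ℝ (⊤ : ℕ∞) (Function.uncurry u) (Set.Iio 0 ×ˢ Set.univ) ∧ (∀ t < 0, Literature.Analysis.FluidPDE.VectorCalculus.IsDivFree (u t)) ∧ (∀ s t : ℝ, s < t → t < 0 → ∀ x, u t x = Literature.Analysis.FluidPDE.heatFlow (u s) (t-s) x - ∫ τ in Set.Ioo s t, ∫ y, ((-(inner ℝ (x-y) (u τ y) / (2*(t-τ)) * Literature.Analysis.UnboundedOperators.heatKernel (t-τ) (x-y))) • u τ y + (∫ σ in Set.Ioi (t-τ), Literature.Analysis.UnboundedOperators.heatKernel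 σ (x-y) / (4*σ^2)) • (inner ℝ (x-y) (u τ y) • u τ y + inner ℝ (u τ y) (u τ y) • (x-y) + inner ℝ (x-y) (u τ y) • u τ y) - ((∫ σ in Set.Ioi (t-τ), Literature.Analysis.UnboundedOperators.heatKernel σ (x-y) / (8*σ^3)) * (inner ℝ (x-y) (u τ y) * inner ℝ (x-y) (u τ y))) • (x-y))) ∧ Literature.Analysis.FluidPDE.HasTypeITimeDecay C u ∧ (∀ (x₀ : EuclideanSpace ℝ (Fin 3)) (t₀ r : ℝ), t₀ ≤ 0 → 0 < r → (∀ t, t₀ - r^2 < t → t < t₀ → r⁻¹ * ∫ x in Metric.ball x₀ r, ‖u t x‖^2 ≤ C) ∧ r⁻¹ * ∫ t in Set.Ioo (t₀ - r^2) t₀, ∫ x in Metric.ball x₀ r, ‖fderiv ℝ (u t) x‖^2 ≤ C)) (hGE : ∃ v w : EuclideanSpace ℝ (Fin 3), ‖v‖ = 1 ∧ ‖w‖ = 1 ∧ inner ℝ v w = 0 ∧ ∀ α β : ℝ, m * (α^2 + β^2) ≤ (-t₀) * inner ℝ (fderiv ℝ (u t₀) x₀ (α • v + β • w)) (α • v +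 β • w)) :
    ∃ u' : ℝ → EuclideanSpace ℝ (Fin 3) → EuclideanSpace ℝ (Fin 3), (ContDiffOn ℝ (⊤ : ℕ∞) (Function.uncurry u') (Set.Iio 0 ×ˢ Set.univ) ∧ (∀ t < 0, Literature.Analysis.FluidPDE.VectorCalculus.IsDivFree (u' t)) ∧ (∀ s t : ℝ, s < t → t < 0 → ∀ x, u' t x = Literature.Analysis.FluidPDE.heatFlow (u' s) (t-s) x - ∫ τ in Set.Ioo s t, ∫ y, ((-(inner ℝ (x-y) (u' τ y) / (2*(t-τ)) * Literature.Analysis.UnboundedOperators.heatKernel (t-τ) (x-y))) • u' τ y + (∫ σ in Set.Ioi (t-τ), Literature.Analysis.UnboundedOperators.heatKernel σ (x-y) / (4*σ^2)) • (inner ℝ (x-y) (u' τ y) • u' τ y + inner ℝ (u' τ y) (u' τ y) • (x-y) + inner ℝ (x-y) (u' τ y) • u' τ y) - ((∫ σ in Set.Ioi (t-τ), Literature.Analysis.UnboundedOperators.heatKernel σ (x-y) / (8*σ^3)) * (inner ℝ (x-y) (u' τ y) * inner ℝ (x-y) (u' τ y))) • (x-y))) ∧ Literature.Analysis.FluidPDE.HasTypeITimeDecay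 C u' ∧ (∀ (x₀ : EuclideanSpace ℝ (Fin 3)) (t₀ r : ℝ), t₀ ≤ 0 → 0 < r → (∀ t, t₀ - r^2 < t → t < t₀ → r⁻¹ * ∫ x in Metric.ball x₀ r, ‖u' t x‖^2 ≤ C) ∧ r⁻¹ * ∫ t in Set.Ioo (t₀ - r^2) t₀, ∫ x in Metric.ball x₀ r, ‖fderiv ℝ (u' t) x‖^2 ≤ C)) ∧ (∃ v w : EuclideanSpace ℝ (Fin 3), ‖v‖ = 1 ∧ ‖w‖ = 1 ∧ inner ℝ v w = 0 ∧ ∀ α β : ℝ, m * (α^2 + β^2) ≤ (-(-1 : ℝ)) * inner ℝ (fderiv ℝ (u' (-1)) 0 (α • v + β • w)) (α • v + β • w)) := by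
  set c : ℝ := Real.sqrt (-t₀) with hc_def
  have hc : 0 < c := Real.sqrt_pos.2 (by linarith)
  have hc2 : c ^ 2 = -t₀ := Real.sq_sqrt (by linarith)
  have hct : c ^ 2 * (-1) = t₀ := by rw [hc2]; ring
  obtain ⟨h1, h2, h3, h4, h5⟩ := hu
  have h : IsTypeIAncientMild C u := isTypeIAncientMild_of_squeezeClass h1 h2 h3 h4
  have hd : ∀ t < 0, Differentiable ℝ (u t) := fun t ht =>
    (h.contDiff_slice ht).differentiable (by simp)
  refine ⟨c • stPull (c ^ 2) c 0 x₀ u, ?_, ?_⟩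
  · -- membership of the zoom
    have hz := isTypeIAncientMild_zoom h hc x₀
    rw [isTypeIAncientMild_iff] at hz
    obtain ⟨hz1, hz2, hz3, hz4⟩ := hz
    refine ⟨hz1, hz2, fun s t hst ht x => ?_, hz4, fun x₁ s₀ r hs₀ hr => ⟨fun s hs1 hs2 => ?_, ?_⟩⟩
    · rw [hz3 s t hst ht x]
      rfl
    · have hc2p : 0 < c ^ 2 := by positivity
      rw [scaledEnergy_zoom hc x₀ x₁ u s hr]
      obtain ⟨hA, -⟩ := h5 (x₀ + c • x₁) (c ^ 2 * s₀) (c * r)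
        (mul_nonpos_of_nonneg_of_nonpos hc2p.le hs₀) (mul_pos hc hr)
      refine hA (c ^ 2 * s) ?_ ?_
      · have : c ^ 2 * (s₀ - r ^ 2) < c ^ 2 * s := mul_lt_mul_of_pos_left hs1 hc2p
        calc c ^ 2 * s₀ - (c * r) ^ 2 = c ^ 2 * (s₀ - r ^ 2) := by ring
          _ < c ^ 2 * s := this
      · exact mul_lt_mul_of_pos_left hs2 hc2p
    · rw [scaledGradEnergy_zoom hc x₀ x₁ u hd hs₀ hr]
      obtain ⟨-, hG⟩ := h5 (x₀ + c • x₁) (c ^ 2 * s₀) (c * r)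
        (mul_nonpos_of_nonneg_of_nonpos (by positivity) hs₀) (mul_pos hc hr)
      exact hG
  · -- attainment at `(-1, 0)`
    have hdt : Differentiable ℝ (u (c ^ 2 * (-1))) := by rw [hct]; exact hd t₀ ht₀
    refine (le_lerayMiddleStrain_iff (show (-1 : ℝ) < 0 by norm_num) m).1 ?_
    rw [lerayMiddleStrain_zoom hc x₀ u (show (-1 : ℝ) < 0 by norm_num) hdt 0, smul_zero, add_zero,
      hct]
    exact (le_lerayMiddleStrain_iff ht₀ m).2 hGE

end Summit.NavierStokesRegularity.NavierStokesRegularity.Theorems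

end
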